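import Literature.Analysis.Fourier.TorusWeightedBandIBP
import Literature.Analysis.Fourier.TorusWeightedDivIBP
import Literature.Analysis.FluidPDE.SawtoothCascadeSmooth
import Literature.Analysis.FluidPDE.ShearStageTransport
import Literature.Analysis.FunctionSpaces.TorusCoordinateFunctions
import HarnessLib

/-!
# K1loc by name (δ₀ = ¼ research line) — helper: THE CONJUGATE ITERATES AND THE WEIGHTED BAND INEQUALITY FOR THE INVISCID CASCADE

Helper file of the prover lane on the crux `K1LocalisedCascade` (stmt-AnomalousDissipation-19491), route `SawtoothPulseCascade`
(γ-agnostic Lagrangian → «hch» entry point; seat memo v18).  The S-D target `hch` of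
`K1Ledger.From.k1Localised_of_thin_lowBand_offCone_frequently` / `…_strip_cone_frequently` bounds Fourier bands of the explicit
inviscid iterates `a 0 = datum`, `b j = a j ∘ Φ_{H,j}`, `a (j+1) = b j ∘ Φ_{V,j}` (`Φ` the shear maps of the rounded-sawtooth profiles
`γ·U_j`).  Here, for ANY cascade parameters with `0 < δ₀`, `0 < d` (real `γ`, any `ρN`, `N₀`):
* `isSmooth_cosDatum`, `datum_sq_add_cosDatum_sq` — the conjugate datum `x ↦ cos (2π x₀)` is smooth and `datum² + cos² = 1`;
* **`exists_conjugate_iterates`** — along the iterates there is a smooth CONJUGATE family `c j` (the iterates of the conjugate datum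
  under the same maps) with `a j x ^ 2 + c j x ^ 2 = 1` for all `j, x` (pointwise identities are transported by composition), and
  every `a j` is smooth;
* **`sqrt_lowBand_iterate_le_weighted`** — consequently, for every phase `n`, every smooth real weight `w`, every `0 ≤ L` and every
  real symbol `0 ≤ χ ≤ 1` vanishing off the horizontal band `|k₀| ≤ L`:
  `√(Σ' χ(k)‖𝓕a_n(k)‖²) ≤ √∫((1 − w pₙ) aₙ)² + (2π)⁻¹ √∫(cₙ ∂₀w)² + L √∫(w cₙ)²`, `pₙ := (cₙ ∂₀aₙ − aₙ ∂₀cₙ)/(2π)` (`= ∂₀φₙ`, the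
  horizontal derivative of the Lagrangian phase) — `Literature.Analysis.Fourier.sqrt_tsum_band_sq_norm_mFourierCoeff_le_of_pair`.
No definitions; nothing is claimed about the size of the three terms (memo v18: at δ₀ = ¼ the first-order chirp term is O(1)).
WHAT THIS IS NOT: not a bound on `hch`. [cite: DEIJ2022, (1.2)–(1.3)] [cite: Grafakos2014, Prop. 3.2.6 (8) and Prop. 3.2.7 (3)] [problem: turb]
-/

-- `Summit.<Summit>.<Problem>`: single-conjunct summit, the duplicate namespace segment is deliberate.
set_option linter.dupNamespace false

noncomputable section

namespace Summit.AnomalousDissipation.AnomalousDissipation.Theorems.SawtoothPulseCascade.K1Lagrange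

open MeasureTheory Set Filter UnitAddTorus Function
open Literature.Analysis Literature.Analysis.FunctionSpaces Literature.Analysis.FunctionSpaces.Torus Literature.Analysis.FluidPDE
open Literature.Analysis.FluidPDE.ShearStage
open Literature.Analysis.FluidPDE.SawtoothCascade Literature.Analysis.FluidPDE.SawtoothCascade.CascadeParams

/-! ## §1 The conjugate datum `cos (2π x₀)` -/

/-- The periodic lift of the conjugate datum `x ↦ cos (2π x₀)` is `y ↦ cos (2π y₀)`. [folklore] -/
theorem lift_cosDatum_eq :
    lift (fun x : UnitAddTorus (Fin 2) => Real.cos (2 * Real.pi * Torus.repr x 0)) =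
      fun y : EuclideanSpace ℝ (Fin 2) => Real.cos (2 * Real.pi * y 0) := by
  funext y
  have hper : Function.Periodic (fun s : ℝ => Real.cos (2 * Real.pi * s)) 1 := fun s => by
    show Real.cos (2 * Real.pi * (s + 1)) = Real.cos (2 * Real.pi * s)
    rw [mul_add, mul_one, Real.cos_add_two_pi]
  exact lift_coordFun_apply hper 0 y

/-- The conjugate datum `x ↦ cos (2π x₀)` is smooth. [folklore] -/
theorem isSmooth_cosDatum : IsSmooth (fun x : UnitAddTorus (Fin 2) => Real.cos (2 * Real.pi * Torus.repr x 0)) := by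
  change ContDiff ℝ _ (lift (fun x : UnitAddTorus (Fin 2) => Real.cos (2 * Real.pi * Torus.repr x 0)))
  rw [lift_cosDatum_eq]
  fun_prop

/-- `datum² + cos² = 1` pointwise. [folklore] -/
theorem datum_sq_add_cosDatum_sq (x : UnitAddTorus (Fin 2)) :
    datum x ^ 2 + Real.cos (2 * Real.pi * Torus.repr x 0) ^ 2 = 1 := by
  unfold datum
  exact Real.sin_sq_add_cos_sq _

/-! ## §2 The conjugate iterates -/

variable (P : CascadeParams)

/-- **The conjugate iterates.**  For the inviscid iterates `a 0 = datum`, `b j = a j ∘ Φ_{H,j}`, `a (j+1) = b j ∘ Φ_{V,j}` of the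
cascade (`0 < δ₀`, `0 < d`, any `γ, N₀, ρN`) there is a family `c j` of smooth functions — the iterates of `cos (2π x₀)` under the same
maps — with `a j x ^ 2 + c j x ^ 2 = 1` for all `j, x`; and every `a j` is smooth. [cite: DEIJ2022, (1.2)–(1.3)] -/
theorem exists_conjugate_iterates (hδ₀ : 0 < P.δ₀) (hd : 0 < P.d) (a b : ℕ → UnitAddTorus (Fin 2) → ℝ) (h0 : a 0 = datum)
    (hb : ∀ j, b j = a j ∘ shearMap 0 1 (amp ⟨P.U j, P.U_periodic j, P.contDiff_U (P.δ_pos hδ₀ hd j)⟩ P.γ))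
    (hab : ∀ j, a (j + 1) = b j ∘ shearMap 1 0 (amp ⟨P.U j, P.U_periodic j, P.contDiff_U (P.δ_pos hδ₀ hd j)⟩ P.γ)) :
    ∃ c : ℕ → UnitAddTorus (Fin 2) → ℝ,
      c 0 = (fun x => Real.cos (2 * Real.pi * Torus.repr x 0)) ∧
      (∀ j, c (j + 1) = (c j ∘ shearMap 0 1 (amp ⟨P.U j, P.U_periodic j, P.contDiff_U (P.δ_pos hδ₀ hd j)⟩ P.γ)) ∘
          shearMap 1 0 (amp ⟨P.U j, P.U_periodic j, P.contDiff_U (P.δ_pos hδ₀ hd j)⟩ P.γ)) ∧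
      (∀ j, IsSmooth (a j)) ∧ (∀ j, IsSmooth (c j)) ∧ (∀ j x, a j x ^ 2 + c j x ^ 2 = 1) := by
  -- the conjugate family by recursion
  let ψ : ℕ → ShearProfile := fun j => amp ⟨P.U j, P.U_periodic j, P.contDiff_U (P.δ_pos hδ₀ hd j)⟩ P.γ
  let c : ℕ → UnitAddTorus (Fin 2) → ℝ := fun j =>
    Nat.rec (fun x => Real.cos (2 * Real.pi * Torus.repr x 0))
      (fun j cj => (cj ∘ shearMap 0 1 (ψ j)) ∘ shearMap 1 0 (ψ j)) j
  have hc0 : c 0 = fun x => Real.cos (2 * Real.pi * Torus.repr x 0) := rfl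
  have hcs : ∀ j, c (j + 1) = (c j ∘ shearMap 0 1 (ψ j)) ∘ shearMap 1 0 (ψ j) := fun j => rfl
  -- `datum` is smooth (its lift is `y ↦ sin (2π y₀)`; cf. `…K3LocalisedClosureEnergyFloor.isSmooth_datum`)
  have hdatum : IsSmooth datum := by
    have hl : lift datum = fun y : EuclideanSpace ℝ (Fin 2) => Real.sin (2 * Real.pi * y 0) := by
      funext y
      have hper : Function.Periodic (fun s : ℝ => Real.sin (2 * Real.pi * s)) 1 := fun s => by
        show Real.sin (2 * Real.pi * (s + 1)) = Real.sin (2 * Real.pi * s)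
        rw [mul_add, mul_one, Real.sin_add_two_pi]
      exact lift_coordFun_apply hper 0 y
    change ContDiff ℝ _ (lift datum)
    rw [hl]
    fun_prop
  refine ⟨c, hc0, hcs, ?_, ?_, ?_⟩
  · intro j
    induction j with
    | zero => rw [h0]; exact hdatum
    | succ j ih => rw [hab j, hb j]; exact (ih.comp_shearMap 0 1 _).comp_shearMap 1 0 _
  · intro j
    induction j with
    | zero => rw [hc0]; exact isSmooth_cosDatum
    | succ j ih => rw [hcs j]; exact (ih.comp_shearMap 0 1 _).comp_shearMap 1 0 _
  · intro j
    induction j with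
    | zero => intro x; rw [h0, hc0]; exact datum_sq_add_cosDatum_sq x
    | succ j ih => intro x; rw [hab j, hb j, hcs j]; exact ih _

/-! ## §3 The weighted horizontal band inequality for the iterates -/

/-- **The weighted band inequality for the inviscid iterates** (entry point of a Lagrangian → `hch` conversion; any real `γ`, any
`ρN`).  For every phase `n` there is a smooth conjugate `cₙ` with `aₙ² + cₙ² = 1` such that for every smooth real weight `w`, every
`0 ≤ L` and every real symbol `0 ≤ χ ≤ 1` vanishing off `|k₀| ≤ L`:
`√(Σ' χ(k)‖𝓕aₙ(k)‖²) ≤ √∫((1 − w pₙ) aₙ)² + (2π)⁻¹ √∫(cₙ ∂₀w)² + L √∫(w cₙ)²` with `pₙ = (cₙ ∂₀aₙ − aₙ ∂₀cₙ)/(2π)`.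
[cite: DEIJ2022, (1.2)–(1.3)] [cite: Grafakos2014, Prop. 3.2.6 (8) and Prop. 3.2.7 (3)] -/
theorem sqrt_lowBand_iterate_le_weighted (hδ₀ : 0 < P.δ₀) (hd : 0 < P.d) (a b : ℕ → UnitAddTorus (Fin 2) → ℝ)
    (h0 : a 0 = datum)
    (hb : ∀ j, b j = a j ∘ shearMap 0 1 (amp ⟨P.U j, P.U_periodic j, P.contDiff_U (P.δ_pos hδ₀ hd j)⟩ P.γ))
    (hab : ∀ j, a (j + 1) = b j ∘ shearMap 1 0 (amp ⟨P.U j, P.U_periodic j, P.contDiff_U (P.δ_pos hδ₀ hd j)⟩ P.γ)) (n : ℕ) :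
    ∃ c : UnitAddTorus (Fin 2) → ℝ, IsSmooth (a n) ∧ IsSmooth c ∧ (∀ x, a n x ^ 2 + c x ^ 2 = 1) ∧
      ∀ (w : UnitAddTorus (Fin 2) → ℝ), IsSmooth w → ∀ (L : ℝ), 0 ≤ L → ∀ (χ : (Fin 2 → ℤ) → ℝ),
        (∀ k, 0 ≤ χ k) → (∀ k, χ k ≤ 1) → (∀ k, L < |(k 0 : ℝ)| → χ k = 0) →
        Real.sqrt (∑' k, χ k * ‖mFourierCoeff (fun x => (a n x : ℂ)) k‖ ^ 2) ≤
          Real.sqrt (∫ x, ((1 - w x * ((c x * partialDeriv 0 (a n) x - a n x * partialDeriv 0 c x) / (2 * Real.pi))) * a n x) ^ 2) +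
            1 / (2 * Real.pi) * Real.sqrt (∫ x, (c x * partialDeriv 0 w x) ^ 2) +
              L * Real.sqrt (∫ x, (w x * c x) ^ 2) := by
  obtain ⟨c, -, -, ha, hc, h1⟩ := exists_conjugate_iterates P hδ₀ hd a b h0 hb hab
  exact ⟨c n, ha n, hc n, h1 n, fun w hw L hL χ hχ0 hχ1 hχL =>
    Literature.Analysis.Fourier.sqrt_tsum_band_sq_norm_mFourierCoeff_le_of_pair (ha n) (hc n) (h1 n) hw 0 hL hχ0 hχ1 hχL⟩

end Summit.AnomalousDissipation.AnomalousDissipation.Theorems.SawtoothPulseCascade.K1Lagrange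

end
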